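/-
Copyright (c) 2026 the pub-hodgecm-mathlib formalisation cell (harness21).  Prover seat hodgecm-mathlib-K2Liu-p26 (g0): Track B «K2-LIT»,
#184♮ = hLiu418 = stmt-HodgeConjecture-24832; #42S organ S1, the (G) organ ROW (ρ-mid), step (M1): the MIDDLE-CELL VALUES OF THE TENSOR DATUM are those of the
BLOCK DATUM (σ22 (D2): (M1)+(M2) → K2Liu-p26; desk K2Liu-p01 (g9) 15:27:20Z; F0P2-p07 (g0) 15:35:57Z: generic non-split — here: ANY finite place, no `hv`∕`h2`).
-/
import Summits.HodgeConjecture.HodgeConjecture.Theorems.K2LiuLocalSWTensorBlockTransport   -- ★ (R-b) FILE 2: `swSectionLoc_localSplittingDatumCM_finSum`, `map_proj_frameMp_symm_pd_deltaLagrangian`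
import Summits.HodgeConjecture.HodgeConjecture.Theorems.K2LiuLocalSWTensorBlockFrame       -- ★ (R-b) FILE 1: `frameConj_blockFlip_eq_tensorEmbLoc_flip` (Θ-1), `frameConj_nElem` (Θ-3), the permutation frame
import Summits.HodgeConjecture.HodgeConjecture.Theorems.K2LiuLocalSWTensorBigCellLetters   -- ★ `tensorEmbLoc_nElem`, `skew_reindex_kronecker_one`
import Summits.HodgeConjecture.HodgeConjecture.Theorems.K2LiuLocalSWFlipElements           -- ★ `adapt_matA_blkLoc_weylDelta` ((R-b2-ii): `blkLoc (w_Δ^{T₁})` is the block flip)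
import HarnessLib

/-!
# Crux `HLiu418`, #42S organ S1, (G) organ ROW (ρ-mid), step (M1): THE MIDDLE-CELL VALUES OF THE WITNESS SECTIONS ON THE TENSOR DATUM ARE BLOCK-DATUM
# MIDDLE-CELL VALUES — `F^{𝕍⊗V′}_{Ψ}(w₁ · n(t)) = F^{T₁⊕T₂}_{frameOp⁻¹Ψ}(blkLoc(w_Δ^{T₁}) · n(t′))` through the permutation frame `PD` (`P_v t′ P_v⁻¹ = t ⊗ 1`)

Cell `hodgecm-mathlib`, crux item hLiu418 = `stmt-HodgeConjecture-24832`, route of record `HCCMUnconditional`; squad K2 ∕ K2Liu, road `K2_Liu`, socket #42S (a),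
organ S1; LEAD F0P6-plan (g14), desk K2Liu-p01 (g9).  THEOREMS ONLY (no `def`, no `instance`, no `notation`, no named-fact hypothesis, no `sorry`); lane
`--supports stmt-HodgeConjecture-24832` (count-neutral helper).

WHY.  ★ `K2LiuInertWitnessOffBigCellAssembly.exists_mu_hf₀off_of_readings` leaves the (G) organ with the two middle-cell FACTORISATION ROWS
`F_{Φ_ε}(w₁·x) = K_ε·g(x)` (`x ∈ P_Δ`).  Their computation ((M1) ∘ (M2), K2Liu-p01 (g9) 15:27:20Z) starts from ★ F6c `K2LiuLocalSWMiddleCellValues.exists_ne_zero_swSectionLoc_blkLoc_weylDelta_mul_nElem`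
(`F_Ψ(blkLoc(w_Δ^{T₁}) · n(t)) = c · Λ(op(P)⁻¹ (unipOpPi c_t (op(P) Ψ)))`), which is typed on the BLOCK datum `T₁ ⊕ᶠ T₂`, while the witness sections live on the TENSOR
datum `𝕍 ⊗ V′` (★ `swSectionTensorLoc`, `h ↦ h ⊗ 1_{V′}`).  This file is the TRANSPORT step (M1): for `n = 2`, two lines `i₀ ≠ i₁`, the permutation frame `P = σ`
of ★ (R-b) FILE 1 (`Pᵀ · gramR(𝕍 ⊗ V′) · P = T₁ ⊕ᶠ T₂`, `T_k = t_{i_k} · diag dV′`, `PD = P ⊕ P`), a flip `w₁` of the line `i₀` and a Siegel unipotent `n(t)` of `U(𝕍^𝔻)`: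
* **`swSectionTensorLoc_flip_mul_nElem_eq_block`** — `swSectionTensorLoc …(dV′)… Σ_{T₀} m₀ Ψ (w₁ · n(t)) = swSectionLoc Σ_{T₁⊕T₂} (frameMp_{PD}⁻¹ m₀) (frameOp_{PD}⁻¹ Ψ) (blkLoc(w_Δ^{T₁}) · n(t′))`
  for every block-side skew `t′` with `P_v t′ P_v⁻¹ = reindex epsV (t ⊗ₖ 1)` (letter `hPX`; `t ⊗ 1` is the adapted block of `n(t) ⊗ 1_{V′}`, ★ `tensorEmbLoc_nElem`):
  ★ `swSectionTensorLoc_apply` (`F^{𝕍⊗V′}_Ψ = F_Ψ ∘ tensorEmbLoc`) ∘ ★ (Θ-1) `frameConj_blockFlip_eq_tensorEmbLoc_flip` (`PD · blkLoc(w_Δ^{T₁}) · PD⁻¹ = w₁ ⊗ 1`, the block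
  flip's adapted matrix being ★ `adapt_matA_blkLoc_weylDelta`) ∘ ★ (Θ-3) `frameConj_nElem` ∘ ★ (R-b1) `swSectionLoc_localSplittingDatumCM_finSum` (Kudla's rigidity:
  `frameSection_{PD} Σ_{T₀} = Σ_{T₁⊕T₂}`).  ANY finite place `v` (no inertness, no `hv`∕`h2`: F0P2-p07's generic request), any `m₀`, any `Ψ`.
* **`map_proj_frameMp_symm_of_mover`** — the transported outer implementer `frameMp_{PD}⁻¹ m₀` is again a mover of `ℓ_Δ` onto `ℓ_Y` (★ `map_proj_frameMp_symm_pd_deltaLagrangian`),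
  i.e. the `hm₀` slot of ★ F6c — so (M2) applies ★ F6c VERBATIM to the right-hand side and reads `Λ` on `frameOp⁻¹ Φ_ε` through the (H3) reading.
References: [MoeglinVignerasWaldspurger1987] Chap. 2 II Remarque (3) (transport of structure); [Kudla1994] §3 Thm. 3.1; [HarrisKudlaSweet1996] §1 (1.11), (1.15); [KudlaRallis1994] §1.
HONEST LABEL.  Count-neutral helper; it retires nothing by itself: `HC_CM` is proved only modulo the 7 printed citations (2 remaining named inputs:
hLiu418 = `stmt-HodgeConjecture-24832`, h413 = `stmt-HodgeConjecture-24833`) until rung 0 closes.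
-/

set_option autoImplicit false
-- the mandated namespace repeats the single-problem summit's segment (`HodgeConjecture.HodgeConjecture`)
set_option linter.dupNamespace false

noncomputable section

open scoped Matrix Kronecker
open NumberField IsDedekindDomain MeasureTheory Matrix
open Literature.RepresentationTheory.HeisenbergGroup
open Literature.NumberTheory.Automorphic Literature.NumberTheory.Automorphic.UnitaryGroup Literature.NumberTheory.Weil1964
open Literature.NumberTheory.GaloisRepresentations Literature.RepresentationTheory.HarrisKudlaSweet1996
open Literature.NumberTheory.GelbartRogawski1991 Literature.NumberTheory.GelbartRogawski1991.GRConstruction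
open Literature.NumberTheory.GelbartRogawski1991.AdaptedBlocks
open Literature.NumberTheory.GelbartRogawski1991.UnitaryDualPair
open Literature.NumberTheory.GelbartRogawski1991.UnitaryDualPair.LocalSplitting
open Literature.NumberTheory.GelbartRogawski1991.UnitaryDualPair.LocalSplitting.FrameTransport
open Literature.NumberTheory.GelbartRogawski1991.UnitaryDualPair.LocalSplitting.DoubledBlock
open Literature.NumberTheory.K2Lit.SiegelDoubled
open Summit.HodgeConjecture.HodgeConjecture.Cruxes.HLiu418.K2LiuLocalSWSectionDefs
open Summit.HodgeConjecture.HodgeConjecture.Cruxes.HLiu418.K2LiuLocalSWTensorBlockTransport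
open Summit.HodgeConjecture.HodgeConjecture.Cruxes.HLiu418.K2LiuLocalSWTensorBlockFrame
open Summit.HodgeConjecture.HodgeConjecture.Cruxes.HLiu418.K2LiuLocalSWTensorBigCellLetters
open Summit.HodgeConjecture.HodgeConjecture.Cruxes.HLiu418.K2LiuLocalSWFlipElements

namespace Summit.HodgeConjecture.HodgeConjecture.Cruxes.HLiu418.K2LiuLocalSWTensorMiddleCellTransport

variable (L : Type) [Field L] [NumberField L] [IsCMField L]
variable {N M : ℕ} (e : Fin N × Fin M ≃ Fin 2)
  (dV : Fin N → L) (hdV : ∀ i, IsCMField.complexConj L (dV i) = dV i)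
  (dW : Fin M → L) (hdW : ∀ i, IsCMField.complexConj L (dW i) = dW i)
variable {M₂ M' : ℕ} (eW : Fin M × Fin M₂ ≃ Fin M') (e' : Fin N × Fin M' ≃ Fin (M₂ + M₂))
  (dV' : Fin M₂ → L) (hdV' : ∀ k, IsCMField.complexConj L (dV' k) = dV' k)
  (v : HeightOneSpectrum (𝓞 (Fp L)))
  [MeasurableSpace (v.adicCompletion (Fp L))] [BorelSpace (v.adicCompletion (Fp L))]
  (μ : Measure (v.adicCompletion (Fp L))) [μ.IsAddHaarMeasure]
  (χ : HeckeCharacter L) (hχ : IsSplittingChar L 1 χ)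

/-! ## §1 The transported outer implementer is a mover -/

omit [MeasurableSpace (v.adicCompletion (Fp L))] [BorelSpace (v.adicCompletion (Fp L))] in
/-- **the `hm₀` slot of ★ F6c for the transported implementer**: `frameMp_{PD}⁻¹ m₀` carries `ℓ_Δ` onto `ℓ_Y` when `m₀` does (★ `map_proj_frameMp_symm_pd_deltaLagrangian`,
restated at the tensor∕block frame of this file). [cite: MoeglinVignerasWaldspurger1987, Chap. 2 II Remarque (3)] [cite: Kudla1994, §3 Thm. 3.1] -/
theorem map_proj_frameMp_symm_of_mover {T₁ T₂ : Matrix (Fin M₂) (Fin M₂) (Fp L)} (P : GL (Fin (M₂ + M₂)) (Fp L))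
    (hP : ((P : Matrix (Fin (M₂ + M₂)) (Fin (M₂ + M₂)) (Fp L)))ᵀ *
        gramR L e' dV hdV (tensorFrame L dW eW dV') (tensorFrame_real L dW hdW eW dV' hdV') * (P : Matrix _ _ (Fp L)) =
      UnitaryGroup.finSum M₂ M₂ T₁ T₂)
    {PD : GL (Fin ((M₂ + M₂) + (M₂ + M₂))) (Fp L)} (hPD : PD = UnitaryGroup.reindexGL (e₂ (M₂ + M₂)) (UnitaryGroup.blockDiagGL (P, P)))
    (m₀ : LocalMp (Fp L) ((M₂ + M₂) + (M₂ + M₂))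
      (gramD (Fp L) (M₂ + M₂) (gramR L e' dV hdV (tensorFrame L dW eW dV') (tensorFrame_real L dW hdW eW dV' hdV'))) v)
    (hm₀ : (deltaLagrangian (Fp L) v (M₂ + M₂)).map (toLin (Fp L) v (MpPsi.proj _ m₀)) = lagrangianY (Fp L) ((M₂ + M₂) + (M₂ + M₂)) v) :
    (deltaLagrangian (Fp L) v (M₂ + M₂)).map (toLin (Fp L) v (MpPsi.proj _
        ((frameMp (Fp L) v ((M₂ + M₂) + (M₂ + M₂)) PD (transpose_pd_mul_gramD_mul_pd (Fp L) (M₂ + M₂) P hP hPD)).symm m₀))) =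
      lagrangianY (Fp L) ((M₂ + M₂) + (M₂ + M₂)) v :=
  map_proj_frameMp_symm_pd_deltaLagrangian L v P hPD (transpose_pd_mul_gramD_mul_pd (Fp L) (M₂ + M₂) P hP hPD) m₀ hm₀

/-! ## §2 The transport identity (M1) -/

set_option maxHeartbeats 800000 in -- MEASURED: 400000 times out (the `(M₂+M₂)+(M₂+M₂)` doubled CM datum telescopes of ★ (R-b) FILES 1–2, 800000 ∕ 400000 there)
/-- **(M1) THE MIDDLE-CELL VALUES OF THE TENSOR DATUM ARE BLOCK-DATUM MIDDLE-CELL VALUES.**  For `n = 2`, lines `i₀ ≠ i₁`, the block permutation `σ` and its matrix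
`P` (★ (R-b) FILE 1 `exists_blockPerm`, `exists_permGL`), the Gram identity `Pᵀ · gramR(𝕍 ⊗ V′) · P = T₁ ⊕ᶠ T₂` (`hP`, ★ `transpose_perm_mul_gramR_mul_perm`) with
`T₁ ⊕ᶠ T₂` diagonal (`hT'`) and invertible (`hT₀'d`), `PD = P ⊕ P`, a flip `w₁` of the line `i₀` (`hw₁`), a skew `t` of `U(𝕍^𝔻)(L⁺_v)` and a block-side skew `t′`
with `P_v t′ P_v⁻¹ = reindex epsV (t ⊗ₖ 1)` (`hPX`), ANY `m₀` and `Ψ`: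
`swSectionTensorLoc … Σ_{T₀} m₀ Ψ (w₁ · n(t)) = swSectionLoc Σ_{T₁⊕ᶠT₂} (frameMp_{PD}⁻¹ m₀) (frameOp_{PD}⁻¹ Ψ) (blkLoc(w_Δ^{T₁}) · n(t′))` — the right-hand side is
EXACTLY the left-hand side of ★ F6c `exists_ne_zero_swSectionLoc_blkLoc_weylDelta_mul_nElem` (block datum `UnitaryGroup.finSum M₂ M₂ T₁ T₂`, `n₁ = n₂ = M₂`).
[cite: MoeglinVignerasWaldspurger1987, Chap. 2 II Remarque (3)] [cite: Kudla1994, §3 Thm. 3.1] [cite: HarrisKudlaSweet1996, §1 (1.11), (1.15)] [cite: KudlaRallis1994, §1] -/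
theorem swSectionTensorLoc_flip_mul_nElem_eq_block (hM₂ : 0 < M₂ + M₂)
    (hT₀d : IsUnit (gramR L e' dV hdV (tensorFrame L dW eW dV') (tensorFrame_real L dW hdW eW dV' hdV')).det)
    {i₀ i₁ : Fin 2} (hi : i₀ ≠ i₁) {σ : Equiv.Perm (Fin (M₂ + M₂))}
    (hσ₀ : ∀ k, σ (epsV e eW e' (i₀, k)) = finSumFinEquiv (Sum.inl k)) (hσ₁ : ∀ k, σ (epsV e eW e' (i₁, k)) = finSumFinEquiv (Sum.inr k))
    {T₁ T₂ : Matrix (Fin M₂) (Fin M₂) (Fp L)}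
    (P : GL (Fin (M₂ + M₂)) (Fp L)) (hPσ : (P : Matrix (Fin (M₂ + M₂)) (Fin (M₂ + M₂)) (Fp L)) = σ.toPEquiv.toMatrix)
    (hP : ((P : Matrix (Fin (M₂ + M₂)) (Fin (M₂ + M₂)) (Fp L)))ᵀ *
        gramR L e' dV hdV (tensorFrame L dW eW dV') (tensorFrame_real L dW hdW eW dV' hdV') * (P : Matrix _ _ (Fp L)) =
      UnitaryGroup.finSum M₂ M₂ T₁ T₂)
    (t' : Fin (M₂ + M₂) → Fp L) (hT' : UnitaryGroup.finSum M₂ M₂ T₁ T₂ = Matrix.diagonal t') (hT₀'d : IsUnit (UnitaryGroup.finSum M₂ M₂ T₁ T₂).det)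
    {PD : GL (Fin ((M₂ + M₂) + (M₂ + M₂))) (Fp L)} (hPD : PD = UnitaryGroup.reindexGL (e₂ (M₂ + M₂)) (UnitaryGroup.blockDiagGL (P, P)))
    (m₀ : LocalMp (Fp L) ((M₂ + M₂) + (M₂ + M₂))
      (gramD (Fp L) (M₂ + M₂) (gramR L e' dV hdV (tensorFrame L dW eW dV') (tensorFrame_real L dW hdW eW dV' hdV'))) v)
    (Ψ : SchwartzBruhat (Fin ((M₂ + M₂) + (M₂ + M₂)) → v.adicCompletion (Fp L)))
    {w₁ : UnitaryGroup.localPi L (IsCMField.complexConj L) (2 + 2) (hermD L e dV hdV dW hdW) v}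
    (hw₁ : adapt (matA (Fp L) L (IsCMField.complexConj L) v 2 w₁) =
      Matrix.fromBlocks (1 - Matrix.single i₀ i₀ 1) (Matrix.single i₀ i₀ 1) (Matrix.single i₀ i₀ 1) (1 - Matrix.single i₀ i₀ 1))
    (t : Matrix (Fin 2) (Fin 2) (LocalRing L v))
    (ht : (t.map (conjLocal L (IsCMField.complexConj L) v))ᵀ * gramS (Fp L) L v 2 (gramR L e dV hdV dW hdW) + gramS (Fp L) L v 2 (gramR L e dV hdV dW hdW) * t = 0)
    (tb : Matrix (Fin (M₂ + M₂)) (Fin (M₂ + M₂)) (LocalRing L v))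
    (htb : (tb.map (conjLocal L (IsCMField.complexConj L) v))ᵀ * gramS (Fp L) L v (M₂ + M₂) (UnitaryGroup.finSum M₂ M₂ T₁ T₂) +
      gramS (Fp L) L v (M₂ + M₂) (UnitaryGroup.finSum M₂ M₂ T₁ T₂) * tb = 0)
    (hPX : (P : Matrix (Fin (M₂ + M₂)) (Fin (M₂ + M₂)) (Fp L)).map ((UnitaryGroup.toLocalRing L v).comp (algebraMap (Fp L) (v.adicCompletion (Fp L)))) * tb *
      ((P⁻¹ : GL (Fin (M₂ + M₂)) (Fp L)) : Matrix (Fin (M₂ + M₂)) (Fin (M₂ + M₂)) (Fp L)).map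
        ((UnitaryGroup.toLocalRing L v).comp (algebraMap (Fp L) (v.adicCompletion (Fp L)))) =
      Matrix.reindex (epsV e eW e') (epsV e eW e') (t ⊗ₖ (1 : Matrix (Fin M₂) (Fin M₂) (LocalRing L v)))) :
    swSectionTensorLoc L e dV hdV dW hdW eW e' dV' hdV' v
        (localSplittingDatumCM L v μ (M₂ + M₂)
          (gramR_isSymm L e' dV hdV (tensorFrame L dW eW dV') (tensorFrame_real L dW hdW eW dV' hdV')) hT₀d
          (hermD_eq_map_gramD L e' dV hdV (tensorFrame L dW eW dV') (tensorFrame_real L dW hdW eW dV' hdV')) χ hχ).localSplitting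
        m₀ Ψ
        (w₁ * nElem (Fp L) L (IsCMField.complexConj L) v 2 (T₀ := gramR L e dV hdV dW hdW) (hermD_eq_map_gramD L e dV hdV dW hdW) t ht) =
      swSectionLoc L v
        (localSplittingDatumCM L v μ (M₂ + M₂) (hT' ▸ Matrix.isSymm_diagonal t') hT₀'d
          (rfl : (gramD (Fp L) (M₂ + M₂) (UnitaryGroup.finSum M₂ M₂ T₁ T₂)).map (algebraMap (Fp L) L) =
            (gramD (Fp L) (M₂ + M₂) (UnitaryGroup.finSum M₂ M₂ T₁ T₂)).map (algebraMap (Fp L) L)) χ hχ).localSplitting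
        ((frameMp (Fp L) v ((M₂ + M₂) + (M₂ + M₂)) PD (transpose_pd_mul_gramD_mul_pd (Fp L) (M₂ + M₂) P hP hPD)).symm m₀)
        ((frameOp (Fp L) v ((M₂ + M₂) + (M₂ + M₂)) PD).symm Ψ)
        (blkLoc (Fp L) L (IsCMField.complexConj L) v M₂ M₂ (T₁ := T₁) (T₂ := T₂) rfl rfl
            (weylDelta (Fp L) L (IsCMField.complexConj L) v M₂ (T₀ := T₁) rfl) *
          nElem (Fp L) L (IsCMField.complexConj L) v (M₂ + M₂) (T₀ := UnitaryGroup.finSum M₂ M₂ T₁ T₂) rfl tb htb) := by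
  -- the block side read through the frame (★ (R-b1)) and `frameOp (frameOp⁻¹ Ψ) = Ψ`
  rw [swSectionLoc_localSplittingDatumCM_finSum L v μ hM₂
    (gramR_isSymm L e' dV hdV (tensorFrame L dW eW dV') (tensorFrame_real L dW hdW eW dV' hdV')) hT₀d t' hT' hT₀'d P hP hPD
    (hermD_eq_map_gramD L e' dV hdV (tensorFrame L dW eW dV') (tensorFrame_real L dW hdW eW dV' hdV')) rfl χ hχ m₀,
    LinearEquiv.apply_symm_apply, map_mul]
  -- the frame on the block flip (Θ-1) and on the Siegel unipotent (Θ-3)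
  rw [frameConj_blockFlip_eq_tensorEmbLoc_flip L e dV hdV dW hdW eW e' dV' hdV' v hi hσ₀ hσ₁ P hPσ hP hPD rfl hw₁
      (adapt_matA_blkLoc_weylDelta (Fp L) L (IsCMField.complexConj L) v M₂ M₂ rfl rfl),
    frameConj_nElem (Fp L) L (IsCMField.complexConj L) v (M₂ + M₂)
      (hermD_eq_map_gramD L e' dV hdV (tensorFrame L dW eW dV') (tensorFrame_real L dW hdW eW dV' hdV')) rfl P hP hPD tb htb
      (Matrix.reindex (epsV e eW e') (epsV e eW e') (t ⊗ₖ (1 : Matrix (Fin M₂) (Fin M₂) (LocalRing L v))))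
      (skew_reindex_kronecker_one L e dV hdV dW hdW eW e' dV' hdV' v t ht) hPX,
    ← tensorEmbLoc_nElem L e dV hdV dW hdW eW e' dV' hdV' v t ht, ← map_mul, swSectionTensorLoc_apply]

end Summit.HodgeConjecture.HodgeConjecture.Cruxes.HLiu418.K2LiuLocalSWTensorMiddleCellTransport

end
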